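import Summits.BirchSwinnertonDyer.BirchSwinnertonDyer.Theorems.UniversalToricDescentStrictPlaceTupleSignature
import Summits.BirchSwinnertonDyer.BirchSwinnertonDyer.Theorems.UniversalToricDescentDualPairToolkit
import HarnessLib

/-!
# The strict-place target of the twin in TUPLE form: signature extension, `Γ_c`-equivariance of the tuple map,
# local nilpotence of `conj_{d₁} − 1`, and the tuple count (crux ♭T≤ stmt-BirchSwinnertonDyer-23042
# `DefectTransportModThreePT`, line `sigmacongruence`, stub TS1′ `stub_twinStrictSurj`, assembly (1e) — local half)

Route `UniversalToricDescent`, lead prover `bsd-wall-utd-p1` g16. THEOREMS ONLY (no definition, no named fact, no `sorry`);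
`--supports stmt-BirchSwinnertonDyer-23042`. BSD is not proved by any of this.

Setting: `κ` a `ℤ_p`-extension of a number field `K` with topological generator `γ`, `H = ker κ`, a place `𝔭` finitely
decomposed with exact index `κ(D_𝔭) = p^c ℤ_p` and `d₁ ∈ D_𝔭` with `κ d₁ = p^c` (`…SigmaLocalStabilizer`), `A = E[p^∞]`,
`G = kerD κ 𝔭 = H ∩ D_𝔭`, the local group `𝓗 = H¹(G, A)` (`= H¹(K_{∞,w}, E[p^∞])`), and the signature at `𝔭` of a class
`s ∈ H¹(H, A)`: `σ ↦ res_G(conj_σ s)`.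

* §1 `exists_forall_resKerD_eq_of_forall_tuple` — **tuple surjectivity ⟹ signature surjectivity**: if every tuple
  `(f_i)_{i<p^c}` is `(res_G(conj_{γ^i} s))_i` for some `s` in a subgroup `B ≤ H¹(H, A)`, then every right-`H`-invariant,
  left-`D_𝔭`-equivariant `F : Γ_K → 𝓗` is the signature of some `s ∈ B` (`Γ_K = D_𝔭 γ^{<p^c} H`).
* §2 `resKerD_conjH1_pow_index` — **the tuple map intertwines `conj_{γ^{p^c}}` on `H¹(H, A)` with `conj_{d₁}` on `𝓗`**
  (`γ^{p^c} ∈ d₁ H`, `H` acts trivially on `H¹(H, A)`, `res_G ∘ conj_d = conj_d ∘ res_G`).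
* §3 `isLocNil_conjH1_kerD_sub_one` — **`(p, conj_{d₁} − 1)` is locally nilpotent on `𝓗`** ((A2)_v + (P)_v of
  `…SigmaLocalStabilizer` and `(φ^{pⁿ} = 1, p^k = 0) ⟹ (φ − 1)^{kpⁿ} = 0`); `conjH1_kerD_pow`.
* §4 `natCard_tuple_torsion_fixed_eq_pow` — for the componentwise endomorphism `Ψ` of `Fin m → 𝓗` induced by `conj_{d₁}`:
  `#{f | p^k f = 0, Ψ^{p^n} f = f} = #{y ∈ 𝓗 | p^k y = 0, conj_{d₁^{p^n}} y = y}^m`.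

References: [GreenbergVatsal2000] §2 Prop. (2.1), Cor. (2.3) (pp. 23–25); [GreenbergLNM1716] §1 p. 60, §3 Lemma 3.3;
[Washington1997] §13.1.
-/

set_option autoImplicit false
-- the Theorems namespace of this sub repeats the summit name by design (D-0017 nested layout)
set_option linter.dupNamespace false

noncomputable section

open scoped Classical

namespace Summit.BirchSwinnertonDyer.BirchSwinnertonDyer.Theorems.UniversalToricDescentStrictPlaceGrowth

open Function Field NumberField IsDedekindDomain WeierstrassCurve
open Literature.NumberTheory.GaloisRepresentations Literature.NumberTheory.EllipticCurves
  Literature.NumberTheory.EllipticCurves.GreenbergSelmer Literature.NumberTheory.EllipticCurves.IwasawaDual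
  Summit.BirchSwinnertonDyer.Rank1Residual Summit.BirchSwinnertonDyer.Rank1Residual.X11b
  Summit.BirchSwinnertonDyer.Rank1Residual.X11b.Coinv Summit.BirchSwinnertonDyer.Rank1Residual.X11b.LocBridge
  Summit.BirchSwinnertonDyer.BirchSwinnertonDyer.Theorems.UniversalToricDescentSigmaLocalStabilizer
  Summit.BirchSwinnertonDyer.BirchSwinnertonDyer.Theorems.UniversalToricDescentSigmaLocalImage
  Summit.BirchSwinnertonDyer.BirchSwinnertonDyer.Theorems.UniversalToricDescentTorsionFreeByCount

variable {K : Type} [Field K] [NumberField K] (W : WeierstrassCurve K) [W.IsElliptic] (p : ℕ)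
  [Fact p.Prime] (κ : ZpExtension K p)

/-! ### §1 Tuple surjectivity ⟹ signature surjectivity -/

omit [W.IsElliptic] in
/-- **If every tuple `(f_i)_{i<p^c}` of local classes is `(res_G(conj_{γ^i} s))_i` for some `s ∈ B`, then every
right-`H`-invariant, left-`D_𝔭`-equivariant function `F : Γ_K → H¹(G, E[p^∞])` is the signature `σ ↦ res_G(conj_σ s)` of some
`s ∈ B`**: write `σ = d γ^n h` (`n < p^c`, `…SigmaLocalSurjective.exists_decomp_mul_pow_lt_mul_mem_ker`) and take the tuple
`f_i = F(γ^i)`; then `res_G(conj_σ s) = conj_d res_G(conj_{γ^n} s) = conj_d F(γ^n) = F(d γ^n h)`.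
[cite: GreenbergVatsal2000, §2 Prop. (2.1) and Cor. (2.3) (pp. 23–25)] -/
theorem exists_forall_resKerD_eq_of_forall_tuple {γ : absoluteGaloisGroup K} (hγ : κ.IsTopGenerator γ)
    {𝔭 : HeightOneSpectrum (𝓞 K)} {c : ℕ}
    (hc : ∀ z : ℤ_[p], ∃ d : decomp (K := K) 𝔭, (κ (d : absoluteGaloisGroup K)).toAdd = (p : ℤ_[p]) ^ c * z)
    (B : AddSubgroup (W.subgroupH1 p κ.kerSubgroup))
    (htuple : ∀ f : Fin (p ^ c) → subgroupH1 (kerD κ 𝔭) (W.geomPrimaryTorsion p), ∃ s ∈ B,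
      ∀ i : Fin (p ^ c), resKerD κ (W.geomPrimaryTorsion p) 𝔭 (W.conjH1 p κ.kerSubgroup (γ ^ (i : ℕ)) s) = f i)
    (F : absoluteGaloisGroup K → subgroupH1 (kerD κ 𝔭) (W.geomPrimaryTorsion p))
    (hFH : ∀ (σ h : absoluteGaloisGroup K), h ∈ κ.kerSubgroup → F (σ * h) = F σ)
    (hFD : ∀ (d : decomp (K := K) 𝔭) (σ : absoluteGaloisGroup K),
      F ((d : absoluteGaloisGroup K) * σ) = conjH1 (kerD κ 𝔭) (W.geomPrimaryTorsion p) d (F σ)) :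
    ∃ s ∈ B, ∀ σ : absoluteGaloisGroup K,
      resKerD κ (W.geomPrimaryTorsion p) 𝔭 (W.conjH1 p κ.kerSubgroup σ s) = F σ := by
  obtain ⟨s, hs, hsf⟩ := htuple fun i ↦ F (γ ^ (i : ℕ))
  refine ⟨s, hs, fun σ ↦ ?_⟩
  obtain ⟨d, n, h, hn, hh, rfl⟩ := exists_decomp_mul_pow_lt_mul_mem_ker κ hγ 𝔭 hc σ
  rw [W.conjH1_mul_holds p κ.kerSubgroup, AddMonoidHom.comp_apply, W.conjH1_mul_holds p κ.kerSubgroup,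
    AddMonoidHom.comp_apply, W.conjH1_of_mem_holds p κ.kerSubgroup hh, AddMonoidHom.id_apply,
    resKerD_conjH1, hsf ⟨n, hn⟩, hFH _ h hh, hFD]

/-! ### §2 The tuple map intertwines `conj_{γ^{p^c}}` with `conj_{d₁}` -/

/-- `γ^{p^c} = d₁ · h₁` with `h₁ ∈ H` when `κ d₁ = p^c` and `κ γ = 1`. [cite: Washington1997, §13.1] -/
theorem exists_pow_index_eq_mul_mem_ker {γ : absoluteGaloisGroup K} (hγ : κ.IsTopGenerator γ)
    {𝔭 : HeightOneSpectrum (𝓞 K)} {c : ℕ} (d₁ : decomp (K := K) 𝔭)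
    (hd₁ : (κ (d₁ : absoluteGaloisGroup K)).toAdd = (p : ℤ_[p]) ^ c) :
    ∃ h₁ ∈ κ.kerSubgroup, γ ^ p ^ c = (d₁ : absoluteGaloisGroup K) * h₁ := by
  have hγ' : κ γ = Multiplicative.ofAdd 1 := hγ
  refine ⟨(d₁ : absoluteGaloisGroup K)⁻¹ * γ ^ p ^ c, ?_, by rw [mul_inv_cancel_left]⟩
  rw [ZpExtension.mem_kerSubgroup, map_mul, map_inv, map_pow, hγ']
  apply Multiplicative.toAdd.injective
  rw [toAdd_mul, toAdd_inv, hd₁, ← ofAdd_nsmul, toAdd_ofAdd, nsmul_eq_mul, mul_one, Nat.cast_pow,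
    toAdd_one, neg_add_cancel]

omit [W.IsElliptic] in
/-- **`res_G(conj_{γ^i} conj_{γ^{p^c}} s) = conj_{d₁} res_G(conj_{γ^i} s)`**: the tuple map `s ↦ (res_G(conj_{γ^i} s))_i`
intertwines `conj_{γ^{p^c}}` on `H¹(H, E[p^∞])` with `conj_{d₁}` on each factor `H¹(G, E[p^∞])` (`γ^{p^c} ∈ d₁ H`; `H` acts
trivially; `res_G conj_d = conj_d res_G`). [cite: GreenbergLNM1716, §3 Lemma 3.3 (p. 87)] [cite: SerreGaloisCohomology1997, I §2.5] -/
theorem resKerD_conjH1_pow_index {γ : absoluteGaloisGroup K} (hγ : κ.IsTopGenerator γ)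
    {𝔭 : HeightOneSpectrum (𝓞 K)} {c : ℕ} (d₁ : decomp (K := K) 𝔭)
    (hd₁ : (κ (d₁ : absoluteGaloisGroup K)).toAdd = (p : ℤ_[p]) ^ c) (i : ℕ)
    (s : W.subgroupH1 p κ.kerSubgroup) :
    resKerD κ (W.geomPrimaryTorsion p) 𝔭
        (W.conjH1 p κ.kerSubgroup (γ ^ i) (W.conjH1 p κ.kerSubgroup (γ ^ p ^ c) s)) =
      conjH1 (kerD κ 𝔭) (W.geomPrimaryTorsion p) d₁
        (resKerD κ (W.geomPrimaryTorsion p) 𝔭 (W.conjH1 p κ.kerSubgroup (γ ^ i) s)) := by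
  obtain ⟨h₁, hh₁, hγc⟩ := exists_pow_index_eq_mul_mem_ker p κ hγ d₁ hd₁
  have hcomm : γ ^ i * γ ^ p ^ c = (d₁ : absoluteGaloisGroup K) * h₁ * γ ^ i := by
    rw [← hγc, ← pow_add, ← pow_add, add_comm]
  have h1 : W.conjH1 p κ.kerSubgroup (γ ^ i) (W.conjH1 p κ.kerSubgroup (γ ^ p ^ c) s) =
      W.conjH1 p κ.kerSubgroup ((d₁ : absoluteGaloisGroup K)) (W.conjH1 p κ.kerSubgroup (γ ^ i) s) := by
    rw [← AddMonoidHom.comp_apply (W.conjH1 p κ.kerSubgroup (γ ^ i)), ← W.conjH1_mul_holds p κ.kerSubgroup, hcomm,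
      W.conjH1_mul_holds p κ.kerSubgroup, AddMonoidHom.comp_apply, W.conjH1_mul_holds p κ.kerSubgroup,
      AddMonoidHom.comp_apply, W.conjH1_of_mem_holds p κ.kerSubgroup hh₁, AddMonoidHom.id_apply]
  rw [h1, resKerD_conjH1]

/-! ### §3 Local nilpotence of `conj_{d₁} − 1` on `H¹(G, E[p^∞])` -/

/-- Powers of `conj_d` on `H¹(G, M)` are `conj_{d^n}`. [cite: SerreGaloisCohomology1997, I §2.5] -/
theorem conjH1_kerD_pow {M : Type} [AddCommGroup M] [DistribMulAction (absoluteGaloisGroup K) M]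
    [TopologicalSpace M] [DiscreteTopology M] {𝔭 : HeightOneSpectrum (𝓞 K)} (d : decomp (K := K) 𝔭)
    {φ : AddMonoid.End (subgroupH1 (kerD κ 𝔭) M)} (hφ : ∀ y, φ y = conjH1 (kerD κ 𝔭) M d y) (n : ℕ)
    (y : subgroupH1 (kerD κ 𝔭) M) :
    (φ ^ n) y = conjH1 (kerD κ 𝔭) M (d ^ n) y := by
  induction n generalizing y with
  | zero => rw [pow_zero, pow_zero, AddMonoid.End.one_apply, conjH1_one_holds (kerD κ 𝔭) M, AddMonoidHom.id_apply]
  | succ n ih =>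
    rw [pow_succ, AddMonoid.End.coe_mul, Function.comp_apply, hφ, ih, pow_succ, conjH1_mul_holds (kerD κ 𝔭) M,
      AddMonoidHom.comp_apply]

/-- **`(p, conj_{d₁} − 1)` is locally nilpotent on `H¹(G, M)`** for a `p`-primary discrete `Γ_K`-module `M` with open
stabilisers: every class is killed by a power of `p` ((P)_v) and fixed by `conj_{d₁^{p^t}}` for some `t` ((A2)_v, as
`p^t ∣ κ(d₁^{p^t})`), so `(conj_{d₁} − 1)^{k p^t}` kills it (`IwasawaDual.pow_mul_prime_pow_apply_eq_zero`).
[cite: GreenbergLNM1716, §1 (after Conj. 1.3)] [cite: Washington1997, §13.1] -/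
theorem isLocNil_conjH1_kerD_sub_one {M : Type} [AddCommGroup M] [DistribMulAction (absoluteGaloisGroup K) M]
    [TopologicalSpace M] [DiscreteTopology M]
    (hstab : ∀ m : M, IsOpen (MulAction.stabilizer (absoluteGaloisGroup K) m : Set (absoluteGaloisGroup K)))
    (htor : ∀ m : M, ∃ k : ℕ, p ^ k • m = 0)
    {𝔭 : HeightOneSpectrum (𝓞 K)} {c : ℕ}
    (hc : ∀ z : ℤ_[p], ∃ d : decomp (K := K) 𝔭, (κ (d : absoluteGaloisGroup K)).toAdd = (p : ℤ_[p]) ^ c * z)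
    (d₁ : decomp (K := K) 𝔭) (hd₁ : (κ (d₁ : absoluteGaloisGroup K)).toAdd = (p : ℤ_[p]) ^ c)
    {φ : AddMonoid.End (subgroupH1 (kerD κ 𝔭) M)} (hφ : ∀ y, φ y = conjH1 (kerD κ 𝔭) M d₁ y) :
    IsLocNil p (φ - 1) := by
  refine ⟨fun y ↦ exists_pow_smul_kerD_eq_zero κ htor 𝔭 y, fun y ↦ ?_⟩
  obtain ⟨t, ht⟩ := exists_forall_dvd_imp_conjH1_kerD_eq κ hstab 𝔭 hc y
  obtain ⟨k, hk⟩ := exists_pow_smul_kerD_eq_zero κ htor 𝔭 y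
  have hfix : (φ ^ p ^ t) y = y := by
    rw [conjH1_kerD_pow p κ d₁ hφ]
    refine ht _ ⟨(p : ℤ_[p]) ^ c, ?_⟩
    rw [Subgroup.coe_pow, map_pow, ← ofAdd_toAdd (κ (d₁ : absoluteGaloisGroup K)), ← ofAdd_nsmul, toAdd_ofAdd, hd₁,
      nsmul_eq_mul, Nat.cast_pow]
  exact ⟨k * p ^ t, IwasawaDual.pow_mul_prime_pow_apply_eq_zero (Fact.out : p.Prime) _ t hfix hk⟩

omit [W.IsElliptic] in
/-- The instance for `E[p^∞]`: `(p, conj_{d₁} − 1)` is locally nilpotent on `H¹(G, E[p^∞])`.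
[cite: GreenbergLNM1716, §1 (after Conj. 1.3)] -/
theorem isLocNil_conjH1_kerD_geomPrimaryTorsion_sub_one {𝔭 : HeightOneSpectrum (𝓞 K)} {c : ℕ}
    (hc : ∀ z : ℤ_[p], ∃ d : decomp (K := K) 𝔭, (κ (d : absoluteGaloisGroup K)).toAdd = (p : ℤ_[p]) ^ c * z)
    (d₁ : decomp (K := K) 𝔭) (hd₁ : (κ (d₁ : absoluteGaloisGroup K)).toAdd = (p : ℤ_[p]) ^ c)
    {φ : AddMonoid.End (subgroupH1 (kerD κ 𝔭) (W.geomPrimaryTorsion p))}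
    (hφ : ∀ y, φ y = conjH1 (kerD κ 𝔭) (W.geomPrimaryTorsion p) d₁ y) :
    IsLocNil p (φ - 1) := by
  refine isLocNil_conjH1_kerD_sub_one p κ (fun m ↦ isOpen_stabilizer_geomPrimaryTorsion W p m) (fun m ↦ ?_)
    hc d₁ hd₁ hφ
  obtain ⟨k, hk⟩ := m.2
  exact ⟨k, Subtype.ext (by rw [AddSubgroupClass.coe_nsmul]; exact hk)⟩

/-! ### §4 The tuple count -/

/-- **`#{f : Fin m → 𝓗 | p^k f = 0, Ψ^{p^n} f = f} = #{y ∈ 𝓗 | p^k y = 0, conj_{d₁^{p^n}} y = y}^m`** for the componentwise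
endomorphism `Ψ` induced by `conj_{d₁}` (written with `1 + (Ψ − 1) = Ψ` as in the dual-pair count p646050).
[cite: GreenbergLNM1716, §1 p. 60] -/
theorem natCard_tuple_torsion_fixed_eq_pow {M : Type} [AddCommGroup M] [DistribMulAction (absoluteGaloisGroup K) M]
    [TopologicalSpace M] [DiscreteTopology M] {𝔭 : HeightOneSpectrum (𝓞 K)} (d₁ : decomp (K := K) 𝔭) (m n k : ℕ)
    {φ : AddMonoid.End (subgroupH1 (kerD κ 𝔭) M)} (hφ : ∀ y, φ y = conjH1 (kerD κ 𝔭) M d₁ y)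
    {Ψ : AddMonoid.End (Fin m → subgroupH1 (kerD κ 𝔭) M)}
    (hΨ : ∀ (f : Fin m → subgroupH1 (kerD κ 𝔭) M) (i : Fin m), Ψ f i = φ (f i)) :
    Nat.card ((DistribSMul.toAddMonoidHom (Fin m → subgroupH1 (kerD κ 𝔭) M) (p ^ k)).ker ⊓
        ((1 + (Ψ - 1)) ^ (p ^ n) - 1).ker : AddSubgroup (Fin m → subgroupH1 (kerD κ 𝔭) M)) =
      Nat.card {y : subgroupH1 (kerD κ 𝔭) M // p ^ k • y = 0 ∧ conjH1 (kerD κ 𝔭) M (d₁ ^ p ^ n) y = y} ^ m := by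
  have hfun : Nat.card {y : subgroupH1 (kerD κ 𝔭) M // p ^ k • y = 0 ∧ conjH1 (kerD κ 𝔭) M (d₁ ^ p ^ n) y = y} ^ m =
      Nat.card (Fin m → {y : subgroupH1 (kerD κ 𝔭) M // p ^ k • y = 0 ∧ conjH1 (kerD κ 𝔭) M (d₁ ^ p ^ n) y = y}) := by
    rw [Nat.card_fun, Nat.card_eq_fintype_card (α := Fin m), Fintype.card_fin]
  rw [hfun, ← Nat.card_congr (Equiv.subtypePiEquivPi (β := fun _ : Fin m ↦ subgroupH1 (kerD κ 𝔭) M)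
    (p := fun _ y ↦ p ^ k • y = 0 ∧ conjH1 (kerD κ 𝔭) M (d₁ ^ p ^ n) y = y))]
  refine Nat.card_congr (Equiv.subtypeEquivRight fun f ↦ ?_)
  rw [add_sub_cancel, AddSubgroup.mem_inf, AddMonoidHom.mem_ker, AddMonoidHom.mem_ker, DistribSMul.toAddMonoidHom_apply]
  change p ^ k • f = 0 ∧ (Ψ ^ p ^ n) f - f = 0 ↔ _
  rw [sub_eq_zero, funext_iff, funext_iff]
  refine ⟨fun h i ↦ ⟨?_, ?_⟩, fun h ↦ ⟨fun i ↦ (h i).1, fun i ↦ ?_⟩⟩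
  · exact h.1 i
  · have := h.2 i
    rwa [pow_apply_of_componentwise _ hΨ, conjH1_kerD_pow p κ d₁ hφ] at this
  · rw [pow_apply_of_componentwise _ hΨ, conjH1_kerD_pow p κ d₁ hφ]
    exact (h i).2

end Summit.BirchSwinnertonDyer.BirchSwinnertonDyer.Theorems.UniversalToricDescentStrictPlaceGrowth

end
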